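import Literature.AlgebraicGeometry.Surfaces.K3PowersHodgeOfTranscendentalLattice
import Literature.NumberTheory.QuadraticForms.RepresentationCodimThree
import HarnessLib

/-!
# Rational quadratic spaces of signature `(2, r − 2)`, `r ≤ 5`, embed isometrically into `(U³ ⊕ ⟨−m⟩) ⊗ ℚ`
# (Serre, *Cours d'arithmétique*, Ch. IV §3.3 Thm. 9 / Cor. and §1; Floccari 2026 Thm. 5.11's hypothesis for `ρ ≥ 17`) — PROVED

Family `hodge`, layer `Literature/AlgebraicGeometry/Surfaces`. Written for the cell `hodge-nonav` (planner note
NOTE-KSHC-rank17 Lemma 1 = sketch `RankSeventeenSketch.lean` r3, Prop `DiagEmbedsU3m`, the LAST non-print input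
«W1» of THEOREM A: KSHC(S) and HC(Sᵏ) for every K3 surface with `ρ(S) ≥ 17`, from Floccari 2026 Thm. 5.11 — whose
hypothesis is an isometric embedding `H²_tr(S, ℚ) ↪ (U^{⊕3} ⊕ ⟨−m⟩) ⊗ ℚ` — and the Huybrechts signature fact).
THEOREMS ONLY (two auxiliary `def`s with bodies — explicit coordinate vectors / the slot embedding — no named fact,
no instance; D-0026 net debt `0`).

THE STATEMENT. For `r ≤ 5` and rational weights `w₀, w₁ > 0 > w₂, …, w_{r−1}` there are a positive integer `m` and an
INJECTIVE `ℚ`-linear map `ι : ℚʳ → ℚ⁷ = (U ⊕ U ⊕ U ⊕ ⟨−m⟩)_ℚ` with `(ι x . ι y) = Σ wᵢ xᵢ yᵢ` (the tree's `u3mFormQ m`,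
Gram matrix `u3mGram m`, index set `U3mIndex`, file `K3PowersHodgeOfTranscendentalLattice`).

THE PROOF (as in the note, with the arithmetic input taken from the tree's classification of rational forms). Pad
the weights to `w' = (w, +1, …, −1, …)` of the fixed sign pattern `(+,+,−,−,−)` on `ℚ⁵` (zero-extension is an
isometric injection `ℚʳ ↪ ℚ⁵`). By the tree's PROVED representation theorem in codimension `3`
(`NumberTheory.QuadraticForms.exists_diagIsometric_append_of_three_le`: Serre IV §3.3 Thm. 9 + Prop. 7 — every
non-degenerate rational diagonal form of rank `m + k`, `k ≥ 3`, is isometric to `⟨a⟩ ⊥ ⟨c⟩` for any `⟨a⟩` of rank `m`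
whose numbers of positive and of negative coefficients do not exceed those of the form) `⟨w'⟩ ≅ ⟨1, −1⟩ ⊥ ⟨c₀, c₁, c₂⟩`;
by Sylvester over `ℝ` (`real_diagIsometric_iff`) two of the `cᵢ` are negative, say `c_j < 0`. Now `⟨1, −1⟩_ℚ ≅ U_ℚ`
(`e₀ ↦ (1, ½)`, `e₁ ↦ (1, −½)`), `⟨c⟩ ↪ U_ℚ` for every `c` (`e ↦ (1, c/2)`), and `⟨c_j⟩ ≅ ⟨−m⟩_ℚ` for the positive
integer `m = p q` when `−c_j = p/q` (`e ↦ 1/q`). Composing with the isometry gives `ι`; injectivity follows from the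
isometry property since `⟨w⟩` is non-degenerate.

WHAT IS PROVED.
* `u3mVec`, `u3mFormQ_u3mVec` — coordinates on `ℚ⁷` and the value of the form `U ⊕ U ⊕ U ⊕ ⟨−m⟩` on them.
* `u3mSlotEmbed c j t` and `u3mFormQ_u3mSlotEmbed` — the explicit isometric embedding of `⟨1, −1, c₀, c₁, c₂⟩` (with
  `−m t² = c_j`) into `(U³ ⊕ ⟨−m⟩)_ℚ`.
* `exists_u3m_embedding_five` — the case `r = 5`, sign pattern `(+,+,−,−,−)`.
* **`exists_u3m_embedding_of_le_five`** — `r ≤ 5`, weights `w i > 0` (`i < 2`), `w i < 0` (`i ≥ 2`): `∃ m > 0`,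
  `∃ ι` injective with `u3mFormQ m (ι x) (ι y) = Σ wᵢ xᵢ yᵢ`; **`diagEmbedsU3m`** — the same in the binder shape of
  the sketch's `DiagEmbedsU3m` (so that `DiagEmbedsU3m := diagEmbedsU3m` by `rfl`-unfolding, kernel-checked).

## References
* [Serre1973] J.-P. Serre, *A Course in Arithmetic* — Ch. IV §1.3–§1.6 (hyperbolic planes, isotropy), §2.4
  (signature), §3.3 Thm. 9, its Cor. and Prop. 7 (classification of rational forms; via the tree's
  `exists_diagIsometric_append_of_three_le`, `real_diagIsometric_iff`).
* [Floccari2026] S. Floccari, Geom. Topol. 30 (2026) — Thm. 5.11 (the consumer's hypothesis), Lemma 5.5.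
* [Huybrechts2016K3] D. Huybrechts, *Lectures on K3 Surfaces* — Ch. 14 §1 (lattices `U`, embeddings).

## Provenance
Cell `hodge-nonav` (summit `HodgeConjecture`, rung F-H1), seat `littype-FH1-2` (literature-prover, generation 17), W1.
-/

noncomputable section

open Finset Matrix
open Literature.NumberTheory.QuadraticForms

namespace Literature.AlgebraicGeometry.Surfaces

/-! ### §1 Coordinates on `ℚ⁷ = (U ⊕ U ⊕ U ⊕ ⟨−m⟩)_ℚ` and the form -/

/-- The vector of `ℚ⁷` (index set `U3mIndex`) with coordinates `(a₁, a₂ | b₁, b₂ | c₁, c₂ | t)` in the three hyperbolic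
planes and the `⟨−m⟩` line. [cite: Floccari2026, Thm. 5.11 (§5)] -/
def u3mVec (a₁ a₂ b₁ b₂ c₁ c₂ t : ℚ) : U3mIndex → ℚ
  | Sum.inl (Sum.inl i) => if i = 0 then a₁ else a₂
  | Sum.inl (Sum.inr (Sum.inl i)) => if i = 0 then b₁ else b₂
  | Sum.inl (Sum.inr (Sum.inr i)) => if i = 0 then c₁ else c₂
  | Sum.inr _ => t

/-- **The form `U ⊕ U ⊕ U ⊕ ⟨−m⟩` in coordinates**: `(v . v') = a₁a₂' + a₂a₁' + b₁b₂' + b₂b₁' + c₁c₂' + c₂c₁' − m t t'`.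
[cite: Serre1973, Ch. IV §1.3] [cite: Floccari2026, Thm. 5.11 (§5)] -/
theorem u3mFormQ_u3mVec (m : ℕ) (a₁ a₂ b₁ b₂ c₁ c₂ t a₁' a₂' b₁' b₂' c₁' c₂' t' : ℚ) :
    u3mFormQ m (u3mVec a₁ a₂ b₁ b₂ c₁ c₂ t) (u3mVec a₁' a₂' b₁' b₂' c₁' c₂' t') =
      a₁ * a₂' + a₂ * a₁' + (b₁ * b₂' + b₂ * b₁') + (c₁ * c₂' + c₂ * c₁') - m * t * t' := by
  simp [u3mFormQ, u3mGram, u3mVec, hyperbolicPlaneGram, Fintype.sum_sum_type, Fin.sum_univ_two]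
  ring

/-- The form vanishes against the zero vector. [cite: Serre1973, Ch. IV §1.1] -/
theorem u3mFormQ_zero_left (m : ℕ) (v : U3mIndex → ℚ) : u3mFormQ m 0 v = 0 := by
  simp [u3mFormQ]

/-! ### §2 Diagonal forms: non-degeneracy bookkeeping -/

/-- `Σ aᵢ xᵢ yᵢ = ᵗx · diag(a) · y`. [cite: Serre1973, Ch. IV §1.1] -/
theorem sum_mul_mul_eq_dotProduct_diagonal_mulVec {n : ℕ} (a x y : Fin n → ℚ) :
    ∑ i, a i * x i * y i = x ⬝ᵥ (Matrix.diagonal a *ᵥ y) := by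
  simp only [dotProduct, Matrix.mulVec_diagonal]
  exact Finset.sum_congr rfl fun i _ => by ring

/-- A non-degenerate diagonal form detects vectors: if `Σ aᵢ xᵢ yᵢ = 0` for all `y` (all `aᵢ ≠ 0`) then `x = 0`.
[cite: Serre1973, Ch. IV §1.1 (non-degenerate forms)] -/
theorem eq_zero_of_forall_sum_mul_mul_eq_zero {n : ℕ} {a : Fin n → ℚ} (ha : ∀ i, a i ≠ 0) {x : Fin n → ℚ}
    (h : ∀ y : Fin n → ℚ, ∑ i, a i * x i * y i = 0) : x = 0 := by
  funext i
  have hi := h (Pi.single i 1)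
  simp only [Pi.single_apply, mul_ite, mul_one, mul_zero, Finset.sum_ite_eq', Finset.mem_univ, if_true] at hi
  rcases mul_eq_zero.mp hi with h0 | h0
  · exact absurd h0 (ha i)
  · simpa using h0

/-- **Isometric maps out of non-degenerate diagonal spaces are injective**: if `(ι x . ι y) = Σ aᵢ xᵢ yᵢ` with all
`aᵢ ≠ 0` then `ι` is injective. [cite: Serre1973, Ch. IV §1.1] -/
theorem injective_of_u3mFormQ_eq {n : ℕ} {a : Fin n → ℚ} (ha : ∀ i, a i ≠ 0) {m : ℕ}
    {ι : (Fin n → ℚ) →ₗ[ℚ] (U3mIndex → ℚ)} (hι : ∀ x y, u3mFormQ m (ι x) (ι y) = ∑ i, a i * x i * y i) :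
    Function.Injective ι := by
  intro x x' hxx'
  have h0 : ι (x - x') = 0 := by rw [map_sub, hxx', sub_self]
  have hx : x - x' = 0 :=
    eq_zero_of_forall_sum_mul_mul_eq_zero ha fun y => by rw [← hι, h0, u3mFormQ_zero_left]
  exact sub_eq_zero.1 hx

/-! ### §3 The explicit embedding of `⟨1, −1, c₀, c₁, c₂⟩` into `(U ⊕ U ⊕ U ⊕ ⟨−m⟩)_ℚ` -/

/-- The slot embedding `ℚ⁵ = ℚ² ⊕ ℚ³ → ℚ⁷`: `(x₀, x₁) ↦ (x₀ + x₁, (x₀ − x₁)/2)` in the first `U` (so that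
`⟨1, −1⟩ ≅ U`), the coordinates `x_{2+k}`, `k = j+1, j+2`, to `(x, c_k x / 2)` in the second and third `U`
(`⟨c_k⟩ ↪ U`), and `x_{2+j} ↦ t · x_{2+j}` in `⟨−m⟩`. [cite: Serre1973, Ch. IV §1.3 and §1.6] -/
def u3mSlotEmbed (c : Fin 3 → ℚ) (j : Fin 3) (t : ℚ) : (Fin (2 + 3) → ℚ) →ₗ[ℚ] (U3mIndex → ℚ) where
  toFun x := u3mVec (x (Fin.castAdd 3 0) + x (Fin.castAdd 3 1)) ((x (Fin.castAdd 3 0) - x (Fin.castAdd 3 1)) / 2)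
    (x (Fin.natAdd 2 (j + 1))) (c (j + 1) * x (Fin.natAdd 2 (j + 1)) / 2)
    (x (Fin.natAdd 2 (j + 2))) (c (j + 2) * x (Fin.natAdd 2 (j + 2)) / 2) (t * x (Fin.natAdd 2 j))
  map_add' x y := by
    funext i
    rcases i with ((i | (i | i)) | u)
    all_goals simp only [u3mVec, Pi.add_apply]
    all_goals first | (split_ifs <;> ring) | ring
  map_smul' q x := by
    funext i
    rcases i with ((i | (i | i)) | u)
    all_goals simp only [u3mVec, Pi.smul_apply, smul_eq_mul, RingHom.id_apply]
    all_goals first | (split_ifs <;> ring) | ring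

/-- For `j : Fin 3`, the indices `j`, `j + 1`, `j + 2` exhaust `Fin 3`: reindexing a sum. [folklore] -/
private theorem sum_fin_three_shift (f : Fin 3 → ℚ) (j : Fin 3) : ∑ k, f k = f j + f (j + 1) + f (j + 2) := by
  fin_cases j <;> simp [Fin.sum_univ_three] <;> ring

/-- **The slot embedding is an isometry from `⟨1, −1, c₀, c₁, c₂⟩` to `U ⊕ U ⊕ U ⊕ ⟨−m⟩` whenever `−m t² = c_j`.**
[cite: Serre1973, Ch. IV §1.3 and §1.6] -/
theorem u3mFormQ_u3mSlotEmbed {m : ℕ} {c : Fin 3 → ℚ} {j : Fin 3} {t : ℚ} (hmt : -((m : ℚ) * t * t) = c j)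
    (x y : Fin (2 + 3) → ℚ) :
    u3mFormQ m (u3mSlotEmbed c j t x) (u3mSlotEmbed c j t y) = ∑ i, Fin.append ![(1 : ℚ), -1] c i * x i * y i := by
  rw [Fin.sum_univ_add, Fin.sum_univ_two, sum_fin_three_shift _ j]
  simp only [Fin.append_left, Fin.append_right, Matrix.cons_val_zero, Matrix.cons_val_one]
  change u3mFormQ m (u3mVec _ _ _ _ _ _ _) (u3mVec _ _ _ _ _ _ _) = _
  rw [u3mFormQ_u3mVec, ← hmt]
  ring

/-! ### §4 The case `r = 5`, signature `(2, 3)` -/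

/-- A negative rational is `−m t²` for a positive integer `m` and a rational `t`: `−p/q = −(pq)(1/q)²` (square
classes `ℚ*/ℚ*²` have square-free integer representatives). [cite: Serre1973, Ch. IV §3.3 (`d ∈ ℚ*/ℚ*²`)] -/
theorem exists_nat_mul_sq_eq_of_neg {q : ℚ} (hq : q < 0) : ∃ m : ℕ, 0 < m ∧ ∃ t : ℚ, -((m : ℚ) * t * t) = q := by
  set p := -q with hp
  have hp0 : 0 < p := by linarith
  have hnum : 0 < p.num := Rat.num_pos.2 hp0
  refine ⟨p.num.toNat * p.den, Nat.mul_pos (Int.pos_iff_toNat_pos.1 hnum) p.den_pos, (p.den : ℚ)⁻¹, ?_⟩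
  have hcast : ((p.num.toNat : ℕ) : ℚ) = (p.num : ℚ) := by
    have h := Int.toNat_of_nonneg hnum.le
    exact_mod_cast h
  have hden : (p.den : ℚ) ≠ 0 := by exact_mod_cast p.den_nz
  have hq' : q = -((p.num : ℚ) / p.den) := by rw [Rat.num_div_den]; ring
  rw [Nat.cast_mul, hcast, hq']
  field_simp

/-- **Signature `(2, 3)` in rank `5`**: for rational weights `w₀, w₁ > 0 > w₂, w₃, w₄` there are `m > 0` and an
injective `ℚ`-linear `ι : ℚ⁵ → (U ⊕ U ⊕ U ⊕ ⟨−m⟩)_ℚ` with `(ι x . ι y) = Σ wᵢ xᵢ yᵢ` — `⟨w⟩ ≅ ⟨1, −1⟩ ⊥ ⟨c₀, c₁, c₂⟩`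
(classification of rational forms: the tree's `exists_diagIsometric_append_of_three_le`), two of the `cᵢ` negative
(Sylvester, `real_diagIsometric_iff`), and the explicit slot embedding. [cite: Serre1973, Ch. IV §3.3 Thm. 9, Cor. and Prop. 7; §2.4; §1.3]
[cite: Floccari2026, Thm. 5.11 (§5)] -/
theorem exists_u3m_embedding_five (w : Fin (2 + 3) → ℚ) (hpos : ∀ i, i.val < 2 → 0 < w i)
    (hneg : ∀ i, 2 ≤ i.val → w i < 0) :
    ∃ m : ℕ, 0 < m ∧ ∃ ι : (Fin (2 + 3) → ℚ) →ₗ[ℚ] (U3mIndex → ℚ),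
      Function.Injective ι ∧ ∀ x y, u3mFormQ m (ι x) (ι y) = ∑ i, w i * x i * y i := by
  classical
  have hw0 : ∀ i, w i ≠ 0 := fun i => by
    rcases Nat.lt_or_ge i.val 2 with hi | hi
    · exact (hpos i hi).ne'
    · exact (hneg i hi).ne
  set a : Fin 2 → ℚ := ![1, -1] with ha_def
  have ha0 : ∀ i, a i ≠ 0 := fun i => by fin_cases i <;> simp [a]
  -- sign counts
  have hw_lt0 : ∀ i : Fin (2 + 3), w i < 0 ↔ 2 ≤ i.val := fun i =>
    ⟨fun h => by by_contra h'; exact (lt_asymm h (hpos i (by omega))).elim, fun h => hneg i h⟩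
  have hw_gt0 : ∀ i : Fin (2 + 3), 0 < w i ↔ i.val < 2 := fun i =>
    ⟨fun h => by by_contra h'; exact (lt_asymm h (hneg i (by omega))).elim, fun h => hpos i h⟩
  have hcardw_neg : (univ.filter fun i => w i < 0).card = 3 := by
    rw [Finset.card_eq_sum_ones, Finset.sum_filter]
    simp only [hw_lt0]
    rw [Fin.sum_univ_add, Fin.sum_univ_two, Fin.sum_univ_three]
    simp
  have hcardw_pos : (univ.filter fun i => 0 < w i).card = 2 := by
    rw [Finset.card_eq_sum_ones, Finset.sum_filter]
    simp only [hw_gt0]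
    rw [Fin.sum_univ_add, Fin.sum_univ_two, Fin.sum_univ_three]
    simp
  have hcarda_neg : (univ.filter fun i => a i < 0).card = 1 := by
    rw [Finset.card_eq_sum_ones, Finset.sum_filter, Fin.sum_univ_two]
    norm_num [a]
  have hcarda_pos : (univ.filter fun i => 0 < a i).card = 1 := by
    rw [Finset.card_eq_sum_ones, Finset.sum_filter, Fin.sum_univ_two]
    norm_num [a]
  -- `⟨w⟩ ≅ ⟨1, -1⟩ ⊥ ⟨c⟩`
  obtain ⟨c, hc0, hiso⟩ := exists_diagIsometric_append_of_three_le (m := 2) (k := 3) le_rfl (a := a) (b := w)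
    ha0 hw0 (by rw [hcarda_neg, hcardw_neg]; norm_num) (by rw [hcarda_pos, hcardw_pos]; norm_num)
  -- Sylvester: two of the `c k` are negative; pick one
  have hac0 : ∀ i, Fin.append a c i ≠ 0 := fun i => by
    refine Fin.addCases (fun i => ?_) (fun k => ?_) i
    · rw [Fin.append_left]; exact ha0 i
    · rw [Fin.append_right]; exact hc0 k
  obtain ⟨j, hj⟩ : ∃ j, c j < 0 := by
    by_contra hall
    simp only [not_exists, not_lt] at hall
    have hcpos : ∀ k, 0 < c k := fun k => lt_of_le_of_ne (hall k) (hc0 k).symm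
    have hreal := (real_diagIsometric_iff (fun i => by simpa using hac0 i) (fun i => by simpa using hw0 i)).1
      (hiso.map (Rat.castHom ℝ))
    simp only [Rat.coe_castHom, Rat.cast_lt_zero] at hreal
    rw [hcardw_neg, Finset.card_eq_sum_ones, Finset.sum_filter, Fin.sum_univ_add, Fin.sum_univ_two,
      Fin.sum_univ_three] at hreal
    simp only [Fin.append_left, Fin.append_right] at hreal
    have h3 : ∀ k, ¬ c k < 0 := fun k => not_lt.2 (hcpos k).le
    norm_num [a, h3] at hreal
  -- `-m t² = c j`
  obtain ⟨m, hm, t, hmt⟩ := exists_nat_mul_sq_eq_of_neg hj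
  -- the isometry `g` with `ᵗg diag(1,-1,c) g = diag(w)`
  obtain ⟨g, hg⟩ := hiso
  refine ⟨m, hm, u3mSlotEmbed c j t ∘ₗ Matrix.toLin' (g : Matrix (Fin (2 + 3)) (Fin (2 + 3)) ℚ), ?_, ?_⟩
  · refine injective_of_u3mFormQ_eq (m := m) hw0 fun x y => ?_
    rw [LinearMap.comp_apply, LinearMap.comp_apply, Matrix.toLin'_apply, Matrix.toLin'_apply,
      u3mFormQ_u3mSlotEmbed hmt, sum_mul_mul_eq_dotProduct_diagonal_mulVec,
      sum_mul_mul_eq_dotProduct_diagonal_mulVec, OMeara664.dotProduct_mulVec_congr, hg]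
  · intro x y
    rw [LinearMap.comp_apply, LinearMap.comp_apply, Matrix.toLin'_apply, Matrix.toLin'_apply,
      u3mFormQ_u3mSlotEmbed hmt, sum_mul_mul_eq_dotProduct_diagonal_mulVec,
      sum_mul_mul_eq_dotProduct_diagonal_mulVec, OMeara664.dotProduct_mulVec_congr, hg]

/-! ### §5 Ranks `r ≤ 5` by zero-padding -/

/-- Zero-extension `ℚʳ → ℚ⁵`, the inclusion of `⟨w⟩` into the orthogonal sum `⟨w⟩ ⊥ ⟨w''⟩`.
[cite: Serre1973, Ch. IV §1.2 (orthogonal direct sums)] -/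
def padToFive (r : ℕ) : (Fin r → ℚ) →ₗ[ℚ] (Fin (2 + 3) → ℚ) :=
  LinearMap.pi fun i => if h : i.val < r then LinearMap.proj (⟨i.val, h⟩ : Fin r) else 0

/-- Coordinates of the zero-extension. [cite: Serre1973, Ch. IV §1.2 (orthogonal direct sums)] -/
theorem padToFive_apply (r : ℕ) (x : Fin r → ℚ) (i : Fin (2 + 3)) :
    padToFive r x i = if h : i.val < r then x ⟨i.val, h⟩ else 0 := by
  unfold padToFive
  rw [LinearMap.pi_apply]
  split_ifs <;> simp

/-- **`r ≤ 5`, signature `(2, r − 2)`: every rational diagonal form with weights `w i > 0` for `i < 2` and `w i < 0`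
for `i ≥ 2` embeds isometrically and injectively into `(U ⊕ U ⊕ U ⊕ ⟨−m⟩)_ℚ` for some positive integer `m`** — the
body of the cell's `DiagEmbedsU3m` (NOTE-KSHC-rank17 Lemma 1; W1): pad the weights to the pattern `(+,+,−,−,−)` and
apply the rank-`5` case to the zero-extension. [cite: Serre1973, Ch. IV §3.3 Thm. 9, Cor. and Prop. 7; §1.3]
[cite: Floccari2026, Thm. 5.11 (§5) and Lemma 5.5] -/
theorem exists_u3m_embedding_of_le_five {r : ℕ} (hr : r ≤ 5) (w : Fin r → ℚ)
    (hpos : ∀ i : Fin r, i.val < 2 → 0 < w i) (hneg : ∀ i : Fin r, 2 ≤ i.val → w i < 0) :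
    ∃ m : ℕ, 0 < m ∧ ∃ ι : (Fin r → ℚ) →ₗ[ℚ] (U3mIndex → ℚ),
      Function.Injective ι ∧ ∀ x y, u3mFormQ m (ι x) (ι y) = ∑ i, w i * x i * y i := by
  classical
  have hw0 : ∀ i, w i ≠ 0 := fun i => by
    rcases Nat.lt_or_ge i.val 2 with hi | hi
    · exact (hpos i hi).ne'
    · exact (hneg i hi).ne
  -- padded weights of pattern `(+,+,-,-,-)`
  set w' : Fin (2 + 3) → ℚ := fun i => if h : i.val < r then w ⟨i.val, h⟩ else if i.val < 2 then 1 else -1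
    with hw'_def
  have hpos' : ∀ i, i.val < 2 → 0 < w' i := fun i hi => by
    simp only [w']
    split_ifs with h
    · exact hpos _ hi
    · exact one_pos
  have hneg' : ∀ i, 2 ≤ i.val → w' i < 0 := fun i hi => by
    simp only [w']
    split_ifs with h h2
    · exact hneg _ hi
    · omega
    · norm_num
  obtain ⟨m, hm, ι, -, hι⟩ := exists_u3m_embedding_five w' hpos' hneg'
  -- the padded form restricts to `⟨w⟩`
  have hsum : ∀ x y : Fin r → ℚ, ∑ i, w' i * padToFive r x i * padToFive r y i = ∑ k, w k * x k * y k := by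
    intro x y
    have h1 : ∑ i : Fin (2 + 3), w' i * padToFive r x i * padToFive r y i =
        ∑ n ∈ Finset.range (2 + 3), (if h : n < r then w ⟨n, h⟩ * x ⟨n, h⟩ * y ⟨n, h⟩ else 0) := by
      rw [← Fin.sum_univ_eq_sum_range]
      refine Finset.sum_congr rfl fun i _ => ?_
      simp only [w', padToFive_apply]
      split_ifs <;> simp
    have h2 : ∑ k : Fin r, w k * x k * y k =
        ∑ n ∈ Finset.range r, (if h : n < r then w ⟨n, h⟩ * x ⟨n, h⟩ * y ⟨n, h⟩ else 0) := by
      rw [← Fin.sum_univ_eq_sum_range]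
      refine Finset.sum_congr rfl fun k _ => ?_
      rw [dif_pos k.isLt]
    rw [h1, h2]
    symm
    refine Finset.sum_subset (Finset.range_subset_range.2 (by omega)) fun n hn hnr => ?_
    rw [Finset.mem_range] at hnr
    rw [dif_neg hnr]
  refine ⟨m, hm, ι ∘ₗ padToFive r, ?_, ?_⟩
  · exact injective_of_u3mFormQ_eq (m := m) hw0 fun x y => by
      rw [LinearMap.comp_apply, LinearMap.comp_apply, hι, hsum]
  · intro x y
    rw [LinearMap.comp_apply, LinearMap.comp_apply, hι, hsum]

/-- **The cell's `DiagEmbedsU3m` (NOTE-KSHC-rank17 Lemma 1, sketch `RankSeventeenSketch` r3), symbol for symbol** with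
its local abbreviations `IsK3TypeWeights w := ∀ i, (i.val < 2 → 0 < w i) ∧ (2 ≤ i.val → w i < 0)` and
`diagFormQ w x y := Σ wᵢ xᵢ yᵢ` unfolded: every rational diagonal form of rank `r ≤ 5` with K3-type weights embeds
isometrically and injectively into `(U³ ⊕ ⟨−m⟩) ⊗ ℚ` for some positive integer `m` — the quadratic-form hypothesis
of Floccari's Thm. 5.11 for K3 surfaces of Picard number `ρ ≥ 17`. [cite: Serre1973, Ch. IV §3.3 Thm. 9, Cor. and Prop. 7]
[cite: Floccari2026, Thm. 5.11 (§5) and Lemma 5.5] -/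
theorem diagEmbedsU3m : ∀ (r : ℕ), r ≤ 5 → ∀ (w : Fin r → ℚ),
    (∀ i : Fin r, (i.val < 2 → 0 < w i) ∧ (2 ≤ i.val → w i < 0)) →
      ∃ m : ℕ, 0 < m ∧ ∃ ι : (Fin r → ℚ) →ₗ[ℚ] (U3mIndex → ℚ),
        Function.Injective ι ∧ ∀ x y, u3mFormQ m (ι x) (ι y) = ∑ i, w i * x i * y i :=
  fun _ hr w hw => exists_u3m_embedding_of_le_five hr w (fun i => (hw i).1) (fun i => (hw i).2)

end Literature.AlgebraicGeometry.Surfaces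

end
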